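import Summits.Ventures.CertifiedArithmetic.Expansions.WeakExpansionNonoverlapping

/-!
# Weakly nonoverlapping expansions, part 5 (§8–§9): the adjacency lemmas

HONEST FRAMING (ENGINES group, unit `eng-quad-4`, kernels lane of the `certquad` engine — shared
numerical engines serving client cells; rigour lives in the verifiers; every published number
belongs to a client cell's ledger, not to the engines group): NEW WORK of the lane's Lean line, not a
published result, hence under `Summits/Ventures/` with no citation tag; nothing here is cited anywhere
as a literature fact.  Overview, statements in words, evidence and the proof outline (§1–§11):
module docstring of `WeakExpansion.lean` in this directory.  This file introduces no definitions.

CONTENTS.  §8 `FesInvW.lower_member`: after a nonzero output `h`, `T = ⌊log₂|h|⌋`, either the new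
accumulator and all unprocessed components are multiples of `2^(T+2)` or `|h| = 2^T` (with the
auxiliary `onGrid_of_isFloat_of_two_zpow_le`); §9 `FesInvW.claimN`: the unprocessed components never
contain both an odd multiple of `2^(T+1)` and an odd multiple of `2^(T+2)`.
-/

namespace Summit.Ventures.CertifiedArithmetic.Expansions

open Literature.ComputerArithmetic.JeannerodRump2018
open Literature.ComputerArithmetic.BoldoJeannerodMelquiondMuller2023 hiding twoSum twoSum_fst isFloat_twoSum
open Literature.ComputerArithmetic.Shewchuk1997

variable {p : ℕ} {emin : ℤ} {fl : ℚ → ℚ}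

/-! ### §8  The lower member of an adjacent output pair is a power of two

For Theorem 2 we must know more about a nonzero output `h` (`T = ⌊log₂|h|⌋`) at the moment it is
emitted: EITHER the new accumulator `Q'` and every unprocessed component are multiples of `2^(T+2)` —
then, by the grid invariant of GROW-EXPANSION, every LATER output `w` has `Below 2 h w` — OR
`|h| = 2^T`.  Indeed if `|h| > 2^T` then `|h| ≤ ½ulp(Q + z)` forces `ulp(Q + z) ≥ 2^(T+2)`, whence
`Q' ∈ 2^(T+2)ℤ` and `|Q + z| ≥ 2^(T+1+p)`; the earlier outputs then sum to `< ¼·2^(T+1)` (`h` is not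
a power of two, so its grid is `≤ 2^(T−1)`); so an unprocessed odd multiple `x₀` of `2^(T+1)` puts us in
§5 with `j = T + 1`: in case B `|Q| > 2½·2^(T+1)` contradicts `|Q| ≤ |Σe₁| + |Σf₁| + |Σhs| <
(2¼ + 2^(2−p))·2^(T+1)` (`p ≥ 4`); in case A the same squeeze pins `|Q|` to EXACTLY
`2^(T+1) + 2^T + 2^(T+1−p) = (2^p + 2^(p−1) + 1)·2^(T+1−p)`, which is not a `p`-bit float. -/

/-- A float of magnitude `≥ 2^T` is a multiple of `2^(T+1−p)`. -/
theorem onGrid_of_isFloat_of_two_zpow_le {x : ℚ} (hx : IsFloat p emin x) {T : ℤ}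
    (hT : (2 : ℚ) ^ T ≤ |x|) : OnGrid (T + 1 - p) x := by
  obtain ⟨M, e, hM, -, hxe⟩ := hx
  rcases le_or_gt (T + 1 - p) e with hle | hlt
  · exact OnGrid.mono ⟨M, hxe⟩ hle
  · exfalso
    have h2 : (0 : ℚ) < 2 := by norm_num
    have hM' : |(M : ℚ)| < 2 ^ p := by exact_mod_cast hM
    have : |x| < (2 : ℚ) ^ T :=
      calc |x| = |(M : ℚ)| * (2 : ℚ) ^ e := by rw [hxe, abs_mul, abs_of_pos (zpow_pos h2 _)]
        _ ≤ |(M : ℚ)| * (2 : ℚ) ^ (T - p) :=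
          mul_le_mul_of_nonneg_left (zpow_le_zpow_right₀ (by norm_num) (by omega)) (abs_nonneg _)
        _ < 2 ^ p * (2 : ℚ) ^ (T - p) := mul_lt_mul_of_pos_right hM' (zpow_pos h2 _)
        _ = (2 : ℚ) ^ T := by rw [← zpow_natCast, ← zpow_add₀ h2.ne']; congr 1; ring
    linarith

/-- **LOWER MEMBER.**  From a state of the strengthened invariant (weak inputs, `p ≥ 4`, any
round-to-nearest), after a step `(Q', h) := TWO-SUM(Q, z)` with `h ≠ 0`, `T = ⌊log₂|h|⌋` and the new
grid `2^(T+1)`: either `Q'` and all unprocessed components are multiples of `2^(T+2)`, or `|h| = 2^T`. -/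
theorem FesInvW.lower_member (hp : 4 ≤ p) (hfl : IsRoundNearest p emin fl)
    {e f e₁ f₁ e₂' f₂ : List ℚ} {z Q : ℚ} {hs : List ℚ} {g : ℤ}
    (heF : ∀ x ∈ e, IsFloat p emin x) (hes : IsWeakExpansion e)
    (hfF : ∀ x ∈ f, IsFloat p emin x) (hfs : IsWeakExpansion f)
    (hI : FesInvW p emin e f e₁ f₁ (z :: e₂') f₂ Q hs g) (hzle : ∀ x ∈ f₂, x ≠ 0 → |z| ≤ |x|)
    {Q' h : ℚ} (hQ' : (twoSum fl Q z).1 = Q') (hh : (twoSum fl Q z).2 = h) (hh0 : h ≠ 0)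
    {T : ℤ} (hT : Int.log 2 |h| = T) (hrg' : ∀ x ∈ e₂' ++ f₂, OnGrid (T + 1) x) :
    (OnGrid (T + 2) Q' ∧ ∀ x ∈ e₂' ++ f₂, OnGrid (T + 2) x) ∨ |h| = (2 : ℚ) ^ T := by
  have hp1 : 1 ≤ p := le_trans (by norm_num) hp
  have hp2 : 2 ≤ p := le_trans (by norm_num) hp
  have h2 : (0 : ℚ) < 2 := by norm_num
  have hhF : IsFloat p emin h := hh ▸ (isFloat_twoSum hfl Q z).2
  obtain ⟨hz0, hh_eq, hQ'eq, -, -, hhg, hTh, hhT, -, heT, hSg, -, -⟩ :=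
    FesInvW.prelude hp1 hfl heF hI.inv hQ' hh hh0 hT
  rcases eq_or_lt_of_le hTh with hEq | hTlt
  · exact Or.inr hEq.symm
  left
  -- (1) `|h| ≤ ½ulp(Q + z)` and `Q' ∈ ulp(Q + z)·ℤ`, so `ulp(Q + z) = 2^u` with `u ≥ T + 2`
  obtain ⟨u, -, hu⟩ := exists_ulp_eq_two_zpow (p := p) (emin := emin) (Q + z)
  have herr : |h| ≤ (2 : ℚ) ^ u / 2 := by
    rw [hh_eq, hQ'eq, ← hu]; exact abs_sub_fl_le_half_ulp hp1 hfl (Q + z)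
  have hTu : T + 2 ≤ u := by
    have : (2 : ℚ) ^ (T + 1) < (2 : ℚ) ^ u := by rw [zpow_add_one₀ h2.ne']; linarith
    have := (zpow_lt_zpow_iff_right₀ (by norm_num : (1:ℚ) < 2)).mp this; omega
  have hQ'G2 : OnGrid (T + 2) Q' := by
    obtain ⟨K, hK⟩ := exists_fl_eq_int_mul_ulp hp1 hfl (Q + z)
    rw [hu] at hK
    rw [hQ'eq]; exact OnGrid.mono ⟨K, hK⟩ hTu
  refine ⟨hQ'G2, fun x₀ hx₀ => ?_⟩
  by_contra hnot
  -- (2) the offending `x₀` is an odd multiple of `2^(T+1)`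
  have hx₀0 : x₀ ≠ 0 := fun h0 => hnot (h0 ▸ OnGrid.zero _)
  have he' : e = (e₁ ++ [z]) ++ e₂' := by rw [hI.inv.he]; simp
  have hx₀F : IsFloat p emin x₀ := by
    rcases List.mem_append.mp hx₀ with hx | hx
    · exact heF x₀ (by rw [he']; exact List.mem_append_right _ hx)
    · exact hfF x₀ (by rw [hI.inv.hf]; exact List.mem_append_right _ hx)
  obtain ⟨M₀, j, hM₀, hM₀p, -, hx₀e⟩ := exists_odd_mul_two_zpow hx₀F hx₀0
  obtain rfl : j = T + 1 := by
    have h1 : T + 1 ≤ j := OnGrid.le_of_odd hM₀ (by rw [← hx₀e]; exact hrg' x₀ hx₀)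
    have h2' : ¬ (T + 2 ≤ j) := fun hle => hnot (OnGrid.mono ⟨M₀, hx₀e⟩ hle)
    omega
  -- (3) `|Q + z| ≥ 2^(T+1+p)` (its ulp is `≥ 2^(T+2) > 2^emin`)
  have hX0 : Q + z ≠ 0 := by
    intro h0; apply hh0; rw [hh_eq, hQ'eq, h0, fl_zero hfl, sub_zero]
  have hXbig : (2 : ℚ) ^ (T + 1 + p) ≤ |Q + z| := by
    rw [ulp_of_ne_zero hX0] at hu
    have hmax : max emin (Int.log 2 |Q + z| - p + 1) = u := zpow_right_injective₀ h2 (by norm_num) hu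
    have hL : T + 1 + p ≤ Int.log 2 |Q + z| := by
      rcases le_total emin (Int.log 2 |Q + z| - p + 1) with hle | hle
      · rw [max_eq_right hle] at hmax; omega
      · rw [max_eq_left hle] at hmax; omega
    calc (2 : ℚ) ^ (T + 1 + p) ≤ 2 ^ (Int.log 2 |Q + z|) := zpow_le_zpow_right₀ (by norm_num) hL
      _ ≤ |Q + z| := zpow_log_le_abs hX0
  -- (4) the earlier outputs sum to `< ¼·2^(T+1)`: `h = M_h·2^(v_h)`, `M_h` odd, `|M_h| ≥ 3`
  have hHs : |hs.sum| < (2 : ℚ) ^ (T - 1) := by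
    obtain ⟨Mh, vh, hMh, -, -, hhe⟩ := exists_odd_mul_two_zpow hhF hh0
    have hgv : g ≤ vh := OnGrid.le_of_odd hMh (by rw [← hhe]; exact hhg)
    have hvT : vh ≤ T - 1 := by
      by_contra hlt
      push Not at hlt
      have h2v : (2 : ℚ) ^ T ≤ (2 : ℚ) ^ vh := zpow_le_zpow_right₀ (by norm_num) (by omega)
      have hvpos : (0 : ℚ) < (2 : ℚ) ^ vh := zpow_pos h2 _
      have habs : |h| = |(Mh : ℚ)| * (2 : ℚ) ^ vh := by rw [hhe, abs_mul, abs_of_pos hvpos]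
      have hMh0 : Mh ≠ 0 := by rintro rfl; exact (by decide : ¬ Odd (0 : ℤ)) hMh
      have hM1 : |Mh| = 1 := by
        have hM2 : |(Mh : ℚ)| < 2 := by
          by_contra hge
          push Not at hge
          have : (2 : ℚ) ^ (T + 1) ≤ |h| := by rw [habs, zpow_add_one₀ h2.ne']; nlinarith
          linarith
        have hM2' : |Mh| < 2 := by exact_mod_cast hM2
        have := abs_pos.mpr hMh0
        omega
      have hhv : |h| = (2 : ℚ) ^ vh := by
        rw [habs, show |(Mh : ℚ)| = 1 by exact_mod_cast hM1, one_mul]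
      rw [hhv] at hTlt hhT
      have h1 := (zpow_lt_zpow_iff_right₀ (by norm_num : (1:ℚ) < 2)).mp hTlt
      have h2' := (zpow_lt_zpow_iff_right₀ (by norm_num : (1:ℚ) < 2)).mp hhT
      omega
    exact lt_of_lt_of_le hSg (zpow_le_zpow_right₀ (by norm_num) (by omega))
  -- (5) so the processed inputs sum to `> (2^p − ¼)·2^(T+1)` and §5 applies with `j = T + 1`
  have hQz : Q + z = ((e₁ ++ [z]).sum + f₁.sum) - hs.sum := by
    have := hI.inv.hsum
    rw [List.sum_append, List.sum_singleton]; linear_combination this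
  have hpow1 : (2 : ℚ) ^ (T + 1) = 2 * (2 : ℚ) ^ T := by rw [zpow_add_one₀ h2.ne']; ring
  have hpowm : (2 : ℚ) ^ (T - 1) = (2 : ℚ) ^ T / 2 := by rw [zpow_sub_one₀ h2.ne']; ring
  have hpowp : (2 : ℚ) ^ (T + 1 + p) = 2 ^ p * (2 : ℚ) ^ (T + 1) := by
    rw [zpow_add₀ h2.ne', zpow_natCast]; ring
  have h2T : (0 : ℚ) < (2 : ℚ) ^ T := zpow_pos h2 _
  have h4p : (4 : ℚ) ≤ 2 ^ p :=
    calc (4 : ℚ) = 2 ^ 2 := by norm_num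
      _ ≤ 2 ^ p := pow_le_pow_right₀ (by norm_num) hp2
  have hS' : (2 ^ p - 1 / 4) * (2 : ℚ) ^ (T + 1) < |(e₁ ++ [z]).sum + f₁.sum| := by
    have htri : |Q + z| ≤ |(e₁ ++ [z]).sum + f₁.sum| + |hs.sum| := by
      rw [hQz]; exact abs_sub _ _
    rw [hpowp, hpow1] at hXbig
    rw [hpowm] at hHs
    rw [hpow1]
    nlinarith
  obtain ⟨hx₀f, hFt, hAB⟩ := hI.core hp2 heF hes hfF hfs hzle hz0 hx₀ hM₀ hM₀p hx₀e hS'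
  -- (6) `|Q + z| ≥ 2^(T+1+p) + |h|`, `|Q| ≥ |Q + z| − |z|`, `|Q| ≤ |Σe₁| + |Σf₁| + |Σhs|`
  have hXh : (2 : ℚ) ^ (T + 1 + p) + |h| ≤ |Q + z| := by
    have hmF : IsFloat p emin ((2 : ℚ) ^ p * (2 : ℚ) ^ (T + 1)) :=
      isFloat_two_pow_mul_zpow hp1 (by omega)
    have := abs_sub_fl_le_abs_abs_sub hfl (Q + z) hmF
    rw [← hQ'eq, ← hh_eq, ← hpowp, abs_of_nonneg (sub_nonneg.mpr hXbig)] at this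
    linarith
  have hQge : |Q + z| - |z| ≤ |Q| := by have := abs_add_le Q z; linarith
  have hQle : |Q| ≤ |e₁.sum| + |f₁.sum| + |hs.sum| := by
    have hQeq : Q = e₁.sum + f₁.sum - hs.sum := by have := hI.inv.hsum; linarith
    rw [hQeq]
    have t1 := abs_sub (e₁.sum + f₁.sum) hs.sum
    have t2 := abs_add_le e₁.sum f₁.sum
    linarith
  rw [hpowp] at hXh hXbig
  rcases hAB with ⟨hzA, hE1, hHsA⟩ | ⟨hzB, hE1, hHsB⟩
  · -- case A: `|Q|` is squeezed to `2^(T+1) + 2^T + 2^(T+1−p)` exactly — not a `p`-bit float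
    set d : ℚ := (2 : ℚ) ^ (T + 1 - p) with hd
    have hdpos : 0 < d := zpow_pos h2 _
    obtain ⟨B, hB⟩ : ∃ B : ℤ, (2 : ℤ) ^ p = 4 * B := by
      refine ⟨2 ^ (p - 2), ?_⟩
      have : (2 : ℤ) ^ p = 2 ^ (p - 2) * 2 ^ 2 := by
        rw [← pow_add, Nat.sub_add_cancel hp2]
      rw [this]; ring
    have h4B : (2 : ℚ) ^ p = 4 * (B : ℚ) := by exact_mod_cast hB
    have hu_d : (2 : ℚ) ^ (T + 1) = 4 * B * d := by
      rw [← h4B, hd, ← zpow_natCast, ← zpow_add₀ h2.ne']; congr 1; ring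
    have hT_d : (2 : ℚ) ^ T = 2 * B * d := by
      have : (2 : ℚ) ^ T = (2 : ℚ) ^ (T + 1) / 2 := by rw [zpow_add_one₀ h2.ne']; ring
      rw [this, hu_d]; ring
    have h2d : (2 : ℚ) ^ (T + 1 + 1 - p) = 2 * d := by
      rw [hd, mul_comm, ← zpow_add_one₀ h2.ne']; congr 1; ring
    -- `h` lives on the grid `d·ℤ`, hence `|h| ≥ 2^T + d`
    have hhG : OnGrid (T + 1 - p) h := onGrid_of_isFloat_of_two_zpow_le hhF hTh
    have hη : (2 : ℚ) ^ T + d ≤ |h| := by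
      have := OnGrid.add_two_zpow_le (OnGrid.two_zpow (by omega : T + 1 - (p : ℤ) ≤ T)) hhG.abs hTlt
      rwa [← hd] at this
    -- squeeze: `2^(T+1) + 2^T + d ≤ |Q| < 2^(T+1) + 2^T + 2d`
    have hlow : (2 : ℚ) ^ (T + 1) + (2 : ℚ) ^ T + d ≤ |Q| := by
      rw [hzA] at hQge; linarith
    have hupp : |Q| < (2 : ℚ) ^ (T + 1) + (2 : ℚ) ^ T + d + d := by
      rw [h2d] at hHsA; rw [hpow1] at hE1 hFt ⊢; linarith
    -- `Q` lives on the grid `2d·ℤ` (a float of magnitude `≥ 2^(T+1)`)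
    have hQT1 : (2 : ℚ) ^ (T + 1) ≤ |Q| := by linarith
    have hQG : OnGrid (T + 1 + 1 - p) Q := onGrid_of_isFloat_of_two_zpow_le hI.inv.hQ hQT1
    have hQeqv : |Q| = (2 : ℚ) ^ (T + 1) + (2 : ℚ) ^ T + d := by
      by_contra hne
      have hgt : (2 : ℚ) ^ (T + 1) + (2 : ℚ) ^ T + d < |Q| := lt_of_le_of_ne hlow (Ne.symm hne)
      have hG1 : OnGrid (T + 1 - p) ((2 : ℚ) ^ (T + 1) + (2 : ℚ) ^ T + d) :=
        ((OnGrid.two_zpow (by omega)).add (OnGrid.two_zpow (by omega))).add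
          (hd ▸ OnGrid.two_zpow le_rfl)
      have := OnGrid.add_two_zpow_le hG1 (hQG.mono (by omega)).abs hgt
      rw [← hd] at this; linarith
    -- parity: `|Q| = (6B + 1)·d` would be a multiple of `2d`
    obtain ⟨r, hr⟩ := hQG.abs
    rw [h2d] at hr
    rw [hu_d, hT_d, hr] at hQeqv
    have hq : (r : ℚ) * 2 = 6 * B + 1 := by
      have : ((r : ℚ) * 2) * d = (6 * B + 1) * d := by linarith
      exact mul_right_cancel₀ hdpos.ne' this
    have hint : r * 2 = 6 * B + 1 := by exact_mod_cast hq
    omega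
  · -- case B: `|Q| > 2½·2^(T+1)` but `|Q| < (2¼ + 2^(2−p))·2^(T+1) ≤ 2½·2^(T+1)` (`p ≥ 4`)
    have hsmall : (2 : ℚ) ^ (T + 1 + 2 - p) ≤ (2 : ℚ) ^ (T - 1) :=
      zpow_le_zpow_right₀ (by norm_num) (by omega)
    rw [hzB] at hQge
    rw [hpowm] at hsmall
    rw [hpow1] at hE1 hFt hQge hXh
    linarith

/-! ### §9  After a nonzero output of size `2^T`, the unprocessed components do not contain both an
odd multiple of `2^(T+1)` and an odd multiple of `2^(T+2)`

(The processed inputs sum to `> 2^(T+p)` by Corollary 8(a); two such components bound the processed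
parts of their expansions by `¾·2^(T+1)` resp. `¾·2^(T+2)` — or, when both lie in the same expansion,
the smaller one is exactly `±2^(T+1)` and dominates the other processed part — giving
`|S| < 5½·2^T ≤ 2^(T+p)` for `p ≥ 3`.)  This is what rules out an output adjacent to TWO others. -/

/-- The tail bound of §2 for a processed prefix `l` below a later component `x = M·2^v` (`M` odd)
of the same weakly nonoverlapping expansion `L`. -/
theorem tail_of_sublist {l L : List ℚ} {x : ℚ} (hLF : ∀ y ∈ L, IsFloat p emin y)
    (hL : IsWeakExpansion L) (hsub : (l ++ [x]).Sublist L) {M v : ℤ} (hM : Odd M)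
    (hxe : x = (M : ℚ) * (2 : ℚ) ^ v) : |l.sum| < 3 / 4 * (2 : ℚ) ^ v :=
  abs_sum_lt_of_isWeakExpansion_append'
    (fun y hy => hLF y (hsub.subset (List.mem_append_left _ hy))) (hL.sublist hsub) hM hxe

/-- **NO TWO.**  After a nonzero output `h`, `T = ⌊log₂|h|⌋, the unprocessed components do not
contain both an odd multiple of `2^(T+1)` and an odd multiple of `2^(T+2)` (`p ≥ 3`). -/
theorem FesInvW.claimN (hp : 3 ≤ p) (hfl : IsRoundNearest p emin fl)
    {e f e₁ f₁ e₂' f₂ : List ℚ} {z Q : ℚ} {hs : List ℚ} {g : ℤ}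
    (heF : ∀ x ∈ e, IsFloat p emin x) (hes : IsWeakExpansion e)
    (hfF : ∀ x ∈ f, IsFloat p emin x) (hfs : IsWeakExpansion f)
    (hI : FesInvW p emin e f e₁ f₁ (z :: e₂') f₂ Q hs g) (hzle : ∀ x ∈ f₂, x ≠ 0 → |z| ≤ |x|)
    {Q' h : ℚ} (hQ' : (twoSum fl Q z).1 = Q') (hh : (twoSum fl Q z).2 = h) (hh0 : h ≠ 0)
    {T : ℤ} (hT : Int.log 2 |h| = T) {x y : ℚ} (hx : x ∈ e₂' ++ f₂) (hy : y ∈ e₂' ++ f₂)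
    {Mx My : ℤ} (hMx : Odd Mx) (hMy : Odd My) (hxe : x = (Mx : ℚ) * (2 : ℚ) ^ (T + 1))
    (hye : y = (My : ℚ) * (2 : ℚ) ^ (T + 2)) : False := by
  have hp1 : 1 ≤ p := by omega
  have h2 : (0 : ℚ) < 2 := by norm_num
  have h2T : (0 : ℚ) < (2 : ℚ) ^ T := zpow_pos h2 _
  have h8p : (8 : ℚ) ≤ 2 ^ p :=
    calc (8 : ℚ) = 2 ^ 3 := by norm_num
      _ ≤ 2 ^ p := pow_le_pow_right₀ (by norm_num) hp
  obtain ⟨hz0, -, -, -, -, -, -, -, -, -, -, -, hbig⟩ :=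
    FesInvW.prelude hp1 hfl heF hI.inv hQ' hh hh0 hT
  have he' : e = (e₁ ++ [z]) ++ e₂' := by rw [hI.inv.he]; simp
  have hsube : (e₁ ++ [z]).Sublist e := by rw [he']; exact List.sublist_append_left _ _
  have hsubf : f₁.Sublist f := by rw [hI.inv.hf]; exact List.sublist_append_left _ _
  have hEF : ∀ w ∈ e₁ ++ [z], IsFloat p emin w := fun w hw => heF w (hsube.subset hw)
  have hf₁F : ∀ w ∈ f₁, IsFloat p emin w := fun w hw => hfF w (hsubf.subset hw)
  have hEexp : IsExpansion 1 (e₁ ++ [z]) := (hes.sublist hsube).isExpansion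
  have hf₁exp : IsExpansion 1 f₁ := (hfs.sublist hsubf).isExpansion
  have hMx0 : Mx ≠ 0 := by rintro rfl; exact (by decide : ¬ Odd (0 : ℤ)) hMx
  have hMy0 : My ≠ 0 := by rintro rfl; exact (by decide : ¬ Odd (0 : ℤ)) hMy
  have hx0 : x ≠ 0 := by rw [hxe]; exact mul_ne_zero (by exact_mod_cast hMx0) (zpow_pos h2 _).ne'
  have hy0 : y ≠ 0 := by rw [hye]; exact mul_ne_zero (by exact_mod_cast hMy0) (zpow_pos h2 _).ne'
  have hpT1 : (2 : ℚ) ^ (T + 1) = 2 * (2 : ℚ) ^ T := by rw [zpow_add_one₀ h2.ne']; ring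
  have hpT2 : (2 : ℚ) ^ (T + 2) = 4 * (2 : ℚ) ^ T := by rw [zpow_add₀ h2.ne']; norm_num; ring
  have hpTp : (2 : ℚ) ^ (T + p) = 2 ^ p * (2 : ℚ) ^ T := by
    rw [zpow_add₀ h2.ne', zpow_natCast]; ring
  -- tail bounds (§2) and ordering facts
  have tE : ∀ {w : ℚ}, w ∈ e₂' → ∀ {M v : ℤ}, Odd M → w = (M : ℚ) * (2 : ℚ) ^ v →
      |(e₁ ++ [z]).sum| < 3 / 4 * (2 : ℚ) ^ v := by
    intro w hw M v hM hwe
    have hsubl : ((e₁ ++ [z]) ++ [w]).Sublist e := by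
      rw [he']; exact (List.Sublist.refl _).append (List.singleton_sublist.mpr hw)
    exact tail_of_sublist heF hes hsubl hM hwe
  have tF : ∀ {w : ℚ}, w ∈ f₂ → ∀ {M v : ℤ}, Odd M → w = (M : ℚ) * (2 : ℚ) ^ v →
      |f₁.sum| < 3 / 4 * (2 : ℚ) ^ v := by
    intro w hw M v hM hwe
    have hsubl : (f₁ ++ [w]).Sublist f := by
      rw [hI.inv.hf]; exact (List.Sublist.refl _).append (List.singleton_sublist.mpr hw)
    exact tail_of_sublist hfF hfs hsubl hM hwe
  have hWBz : ∀ w ∈ e₂', WeakBelow z w := by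
    have hpw := hes.1
    rw [hI.inv.he, List.pairwise_append, List.pairwise_cons] at hpw
    exact hpw.2.1.1
  have hsub : ∀ w ∈ e₂' ++ f₂, w ∈ (z :: e₂') ++ f₂ := fun w hw =>
    (List.mem_append.mp hw).elim (fun hw => List.mem_append_left _ (List.mem_cons_of_mem _ hw))
      fun hw => List.mem_append_right _ hw
  have hleE : ∀ w ∈ e₂' ++ f₂, w ≠ 0 → ∀ v ∈ e₁ ++ [z], |v| ≤ |w| := by
    intro w hw hw0 v hv
    rcases List.mem_append.mp hv with hv | hv
    · exact hI.inv.hle v (List.mem_append_left _ hv) w (hsub w hw) hw0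
    · rw [List.mem_singleton.mp hv]
      rcases List.mem_append.mp hw with hw | hw
      · exact ((hWBz w hw).abs_lt hw0).le
      · exact hzle w hw hw0
  have htri := abs_add_le (e₁ ++ [z]).sum f₁.sum
  rw [hpTp] at hbig
  -- a component of the same expansion BELOW an odd multiple `w = M·2^v` is `< 2^v` in magnitude
  have hlt_of_wb : ∀ {a w : ℚ} {M v : ℤ}, Odd M → w = (M : ℚ) * (2 : ℚ) ^ v → WeakBelow a w →
      |a| < (2 : ℚ) ^ v := by
    intro a w M v hM hwe hab
    obtain ⟨s, hs, hlt⟩ := hab.below_one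
    rw [one_mul] at hlt
    exact lt_of_lt_of_le hlt (zpow_le_zpow_right₀ (by norm_num)
      (OnGrid.le_of_odd hM (by rwa [hwe] at hs)))
  rcases List.mem_append.mp hx with hxe' | hxf
  · have hE := tE hxe' hMx hxe
    rcases List.mem_append.mp hy with hye' | hyf
    · -- both in `e`: `|z| < 2^(T+1)` bounds the processed part of `f`
      have hz : |z| < (2 : ℚ) ^ (T + 1) := hlt_of_wb hMx hxe (hWBz x hxe')
      have hF : |f₁.sum| < (2 : ℚ) ^ (T + 1) :=
        abs_sum_lt_two_zpow_of_isExpansion hf₁F hf₁exp fun w hw => lt_of_le_of_lt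
          (hI.inv.hle w (List.mem_append_right _ hw) z
            (List.mem_append_left _ List.mem_cons_self) hz0) hz
      rw [hpT1] at hE hF
      nlinarith
    · have hF := tF hyf hMy hye
      rw [hpT1] at hE; rw [hpT2] at hF
      nlinarith
  · have hF := tF hxf hMx hxe
    rcases List.mem_append.mp hy with hye' | hyf
    · have hE := tE hye' hMy hye
      rw [hpT1] at hF; rw [hpT2] at hE
      nlinarith
    · -- both in `f`: then `|x| = 2^(T+1)` exactly, which bounds the processed part of `e`
      have hxy : x ≠ y := by
        intro hxy
        have : OnGrid (T + 2) x := ⟨My, by rw [hxy, hye]⟩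
        have := OnGrid.le_of_odd hMx (by rwa [hxe] at this)
        omega
      have hxabs : |x| = (2 : ℚ) ^ (T + 1) := by
        obtain ⟨A, B, hAB⟩ := List.append_of_mem hxf
        have hpw : f₂.Pairwise WeakBelow := by
          have := hfs.1; rw [hI.inv.hf, List.pairwise_append] at this; exact this.2.1
        rw [hAB, List.pairwise_append, List.pairwise_cons] at hpw
        have hy' : y ∈ A ++ x :: B := hAB ▸ hyf
        rcases List.mem_append.mp hy' with hyA | hyB
        · -- `y` before `x`: `|y| < 2^(T+1)` — impossible for an odd multiple of `2^(T+2)`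
          exfalso
          have h1 : |y| < (2 : ℚ) ^ (T + 1) := hlt_of_wb hMx hxe (hpw.2.2 y hyA x List.mem_cons_self)
          have h2' : (2 : ℚ) ^ (T + 2) ≤ |y| := by
            rw [hye, abs_mul, abs_of_pos (zpow_pos h2 _)]
            have : (1 : ℚ) ≤ |(My : ℚ)| := by
              have := Int.one_le_abs hMy0; exact_mod_cast this
            nlinarith [zpow_pos h2 (T + 2)]
          rw [hpT1] at h1; rw [hpT2] at h2'; linarith
        · rcases List.mem_cons.mp hyB with rfl | hyB
          · exact absurd rfl hxy
          -- `x` before `y`: `x` is weakly below `y`, and not 2-below it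
          have hwb : WeakBelow x y := hpw.2.1.1 y hyB
          have hxge : (2 : ℚ) ^ (T + 1) ≤ |x| := by
            rw [hxe, abs_mul, abs_of_pos (zpow_pos h2 _)]
            have : (1 : ℚ) ≤ |(Mx : ℚ)| := by
              have := Int.one_le_abs hMx0; exact_mod_cast this
            nlinarith [zpow_pos h2 (T + 1)]
          rcases hwb with ⟨s, hs, hlt⟩ | ⟨-, a, ha⟩
          · exfalso
            have := zpow_le_zpow_right₀ (by norm_num : (1:ℚ) ≤ 2)
              (OnGrid.le_of_odd hMy (by rwa [hye] at hs))
            rw [hpT1] at hxge; rw [hpT2] at this; linarith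
          · rw [hxe] at ha
            obtain ⟨hM1, hav⟩ := abs_eq_one_of_odd_of_abs_eq_two_zpow hMx ha
            rw [hxe, abs_mul, abs_of_pos (zpow_pos h2 _), show |(Mx : ℚ)| = 1 by exact_mod_cast hM1,
              one_mul]
      have hE : |(e₁ ++ [z]).sum| < (2 : ℚ) ^ (T + 2) :=
        abs_sum_lt_two_zpow_of_isExpansion hEF hEexp fun w hw => by
          have := hleE x hx hx0 w hw
          rw [hxabs] at this
          exact lt_of_le_of_lt this (zpow_lt_zpow_right₀ (by norm_num) (by omega))
      rw [hpT1] at hF; rw [hpT2] at hE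
      nlinarith

end Summit.Ventures.CertifiedArithmetic.Expansions
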